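import Mathlib
import HarnessLib

/-!
# Zhang (2022), §4, Lemmas 4.1–4.2 (proofs): the Stieltjes / partial-integration device
# `Σ c(n)n^{s₀−s} = ∫ x^{s₀−s} dX(x)`, its bound by `|X|` and `∫|X|dx/x`, and the two pointwise
# bounds `|x^{s₀−s}| ≪ 𝓛`, `|d/dx x^{s₀−s}| ≪ x^{−1}𝓛^{406}` on `Ω₁`, kernel-checked

Topic `Literature/NumberTheory/LFunctions/Zhang2022` (Landau–Siegel autopsy tree; verdict-neutral).
Y. Zhang, *Discrete mean estimates and the Landau–Siegel zero*, arXiv:2211.02515v1 (2022) — **an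
unrefereed manuscript, a claimed result under adjudication** (cell pub-zhang: audit + repair census
of arXiv:2211.02515; no claim about Landau–Siegel) — §4 p. 8:

> Lemma 4.1. Let `Ω₁ = {s : 1/2 − (100𝓛)⁻¹log 𝓛 < σ < 1 + (100𝓛)⁻¹log 𝓛, |t − 2πt₀| < 𝓛₁ + 5}`.
> If `s ∈ Ω₁`, then `|F(s,ψ)| + |G(s,ψ)| ≪ 𝓛^{79}`.
> Proof. By the Stieltjes integral we may write `F(s,ψ)^{20} = 1 + ∫₁^{D^{80}} x^{s₀−s} d{X₁(x,ψ)}`.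
> For `s ∈ Ω₁` and `1 ≤ x ≤ D^{80}` we have `|x^{s₀−s}| ≪ 𝓛`, `|d/dx (x^{s₀−s})| ≪ x^{−1}𝓛^{406}`.
> Hence, by partial integration, `|F(s,ψ)|^{20} ≪ 1 + 𝓛^{406}(|X₁(D^{80},ψ)| + ∫₁^{D^{80}} |X₁(x,ψ)|x⁻¹dx)`.
> For `G(s,ψ)` an entirely analogous bound is valid. The result now follows by (3.4). □
> Lemma 4.2. If `s ∈ Ω₁`, then `F(s,ψ)G(s,ψ) = 1 + O(𝓛^{−227})`.
> Proof. We have `F(s,ψ)G(s,ψ) − 1 = Σ_{D⁴<n≤D⁸} ς(n)ψ(n)n^{−s} = ∫_{D⁴}^{D⁸} x^{s₀−s} d{X₄(x,ψ)}`.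
> Thus, similar to (4.2), by partial integration we obtain
> `F(s,ψ)G(s,ψ) − 1 ≪ 𝓛^{406}(|X₄(D⁸,ψ)| + ∫_{D⁴}^{D⁸} |X₄(x,ψ)|x⁻¹dx)`,
> the right side being `O(𝓛^{−227})` by (3.6). □

(`𝓛 = log D`, `𝓛₁ = 𝓛^{405}`, `s₀ = 1/2 + 2πit₀` (2.8); `F(s,ψ)^{20} = Σ_{n≤D^{80}} ν₂₀(n)ψ(n)n^{−s}`,
`X₁(x,ψ) = Σ_{n≤x} ν₂₀(n)ψ(n)n^{−s₀}`, `X₄(x,ψ) = Σ_{D⁴<n≤x} ς(n)ψ(n)n^{−s₀}` (§3 p. 7); the same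
device reappears at (4.8) p. 9 — "By partial integration, `Σ_{D⁴<n≤P²} ν(n)ψ(n)n^{−(s*+iv)} =
∫_{D⁴}^{P²} x^{s₀−s*−iv} dX₃(x,ψ) ≪ P^{2σ−1}𝓛₁(|X₃(P²,ψ)| + ∫_{D⁴}^{P²}|X₃(x,ψ)|x⁻¹dx)`".)

Writing `c(n)` for the NORMALISED coefficients (`ν₂₀(n)ψ(n)n^{−s₀}`, `ς(n)ψ(n)n^{−s₀}`, …) and
`z = s₀ − s`, the sums are `Σ c(n)n^{z}` and `X(x) = Σ_{n≤x} c(n)`. This file PROVES, for an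
arbitrary `c : ℕ → ℂ` and `z ∈ ℂ` (namespace `Lemma41`; `Xsum c a x = Σ_{a<n≤x} c(n)`):

* `Lemma41.sum_mul_cpow_eq` — **"by the Stieltjes integral … by partial integration", EXACT**, on any
  range `(a, b]` with `0 < a ≤ b`:
  `Σ_{a<n≤b} c(n)n^{z} = b^{z}X_a(b) − z∫_a^b X_a(x)x^{z−1}dx`, `X_a(x) = Σ_{a<n≤x} c(n)`
  (Mathlib's Abel summation `sum_mul_eq_sub_sub_integral_mul` with `f(x) = x^{z}`); and
  `Lemma41.sum_mul_cpow_eq_one` — the form of Lemma 4.1 (`a = 1`, the term `n = 1` being the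
  manuscript's "`1 +`"): `Σ_{n≤b} c(n)n^{z} = b^{z}X(b) − z∫₁^b X(x)x^{z−1}dx`, `X(x) = Σ_{n≤x} c(n)`;
* `Lemma41.norm_sum_mul_cpow_le` / `norm_sum_mul_cpow_le_one` — **the partial-integration bound**:
  if `x^{Re z} ≤ M` on `[a,b]`, then
  `|Σ_{a<n≤b} c(n)n^{z}| ≤ M|X_a(b)| + |z|·M·∫_a^b |X_a(x)|x⁻¹dx` (resp. with `X`, `a = 1`) — the
  displays "`|F|^{20} ≪ 1 + 𝓛^{406}(|X₁(D^{80})| + ∫|X₁|dx/x)`", "`FG − 1 ≪ 𝓛^{406}(|X₄(D⁸)| + ∫|X₄|dx/x)`"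
  and the (4.8) display, with `M = sup|x^{s₀−s}|` and `|z|M = sup|x·d/dx x^{s₀−s}|` explicit;
* `Lemma41.rpow_re_le` — **"`|x^{s₀−s}| ≪ 𝓛`" EXACT**: for `1 ≤ x ≤ D^{80} = e^{80𝓛}` and
  `Re(s₀−s) ≤ (100𝓛)⁻¹log 𝓛` (i.e. `σ > 1/2 − (100𝓛)⁻¹log 𝓛`), `|x^{s₀−s}| = x^{Re(s₀−s)} ≤ 𝓛^{4/5}`;
  `Lemma41.norm_deriv_cpow_le` — **"`|d/dx x^{s₀−s}| ≪ x^{−1}𝓛^{406}`"**: `d/dx x^{z} = z·x^{z−1}`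
  (`Lemma41.hasDerivAt_ofReal_cpow`) and `|z·x^{z−1}| ≤ |z|𝓛^{4/5}/x` there; with
  `|z| ≤ |Re z| + |Im z| ≤ 1 + (𝓛^{405} + 5)` on `Ω₁` this is `≤ 𝓛^{406}/x` as soon as `𝓛 ≥ 32`
  (`Lemma41.norm_mul_le_rpow_406`: `(𝓛^{405} + 6)𝓛^{4/5} ≤ 𝓛^{406}`);
* `Lemma41.norm_F20_le` — Lemma 4.1's third display assembled: for `𝓛 ≥ 32`, `1 ≤ b ≤ e^{80𝓛}`,
  `Re z ≤ (100𝓛)⁻¹log 𝓛`, `|Re z| ≤ 1`, `|Im z| ≤ 𝓛^{405} + 5`: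
  `|Σ_{n≤b} c(n)n^{z}| ≤ 𝓛^{4/5}|X(b)| + 𝓛^{406}∫₁^b |X(x)|x⁻¹dx`, and the same on `(a,b]`
  (`Lemma41.norm_sum_Ioc_le`, Lemma 4.2's display); `Lemma41.norm_le_rpow_of_pow_le` — the last
  step "`|F|^{20} ≤ 𝓛^{e} ⇒ |F| ≤ 𝓛^{e/20}`".

What is NOT asserted: the mean-value inputs (3.4)–(3.6) (Lemmas 3.4–3.6, tree files
`Section3MeanValues`, `Section3Lemma36*`), hence neither `|F| + |G| ≪ 𝓛^{79}` nor `FG = 1 + O(𝓛^{−227})`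
for `ψ ∈ Ψ₁` as such; the weight `g(P^{9/5}/x)` version used before (4.7) is not treated. Nothing
about Theorems 1–2 of the source is stated or implied; nothing here bears on the cell's verdict on
(8.24).

## References

* Y. Zhang, arXiv:2211.02515v1 (2022), §4 p. 8, Lemma 4.1 (proof, three displays), Lemma 4.2
  (proof, two displays); §4 p. 9, the display after (4.8); §2 (2.7)–(2.8); §3 p. 7 (`F`, `G`, `X₁`–`X₄`).
  [cite: Zhang2022LandauSiegel, §4 Lemma 4.1 (proof)]
* Mathlib, `Mathlib/NumberTheory/AbelSummation.lean` (`sum_mul_eq_sub_sub_integral_mul`).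
-/

noncomputable section

open Complex Real Set MeasureTheory Finset intervalIntegral

namespace Literature.NumberTheory.LFunctions.Zhang2022

namespace Lemma41

/-! ### Partial sums -/

/-- `X_a(x) = Σ_{a<n≤x} c(n)`: the manuscript's `X₃(x,ψ)`, `X₄(x,ψ)` (`a = D⁴`) and, with `a = 0`,
`X₁(x,ψ)`, `X₂(x,ψ)` — partial sums of the normalised coefficients `c(n) = ν(n)ψ(n)n^{−s₀}`.
[cite: Zhang2022LandauSiegel, §3 p. 7 (X₁–X₄)] -/
def Xsum (c : ℕ → ℂ) (a x : ℝ) : ℂ := ∑ n ∈ Finset.Icc (⌊a⌋₊ + 1) ⌊x⌋₊, c n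

/-- Unfolding lemma. [cite: Zhang2022LandauSiegel, §3 p. 7 (X₁–X₄)] -/
lemma Xsum_def (c : ℕ → ℂ) (a x : ℝ) : Xsum c a x = ∑ n ∈ Finset.Icc (⌊a⌋₊ + 1) ⌊x⌋₊, c n := rfl

/-- `X_a(x) = Σ_{n ∈ (⌊a⌋, ⌊x⌋]} c(n)`. [cite: Zhang2022LandauSiegel, §3 p. 7 (X₁–X₄)] -/
lemma Xsum_eq_sum_Ioc (c : ℕ → ℂ) (a x : ℝ) :
    Xsum c a x = ∑ n ∈ Finset.Ioc ⌊a⌋₊ ⌊x⌋₊, c n := by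
  rw [Xsum_def, Finset.Icc_add_one_left_eq_Ioc]

/-- `X_a(a) = 0`. [cite: Zhang2022LandauSiegel, §3 p. 7 (X₁–X₄)] -/
lemma Xsum_self (c : ℕ → ℂ) (a : ℝ) : Xsum c a a = 0 := by
  rw [Xsum_eq_sum_Ioc, Finset.Ioc_self, Finset.sum_empty]

/-- With `a = 0`: `X(x) = Σ_{1≤n≤x} c(n)` (the manuscript's `X₁`, `X₂`).
[cite: Zhang2022LandauSiegel, §3 p. 7 (X₁–X₄)] -/
lemma Xsum_zero (c : ℕ → ℂ) (x : ℝ) : Xsum c 0 x = ∑ n ∈ Finset.Icc 1 ⌊x⌋₊, c n := by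
  rw [Xsum_def, Nat.floor_zero]

/-- The coefficients truncated to `n > m`. [folklore] -/
private def ctrunc (c : ℕ → ℂ) (m : ℕ) (k : ℕ) : ℂ := if m < k then c k else 0

/-- Full partial sums of the truncated coefficients. [folklore] -/
private lemma sum_Icc_ctrunc (c : ℕ → ℂ) (m n : ℕ) :
    ∑ k ∈ Finset.Icc 0 n, ctrunc c m k = ∑ k ∈ Finset.Icc (m + 1) n, c k := by
  unfold ctrunc
  rw [← Finset.sum_filter]
  congr 1
  ext k
  simp only [Finset.mem_filter, Finset.mem_Icc]
  omega

/-! ### The weight `x ↦ x^z` on `[a, b]`, `a > 0` -/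

/-- `d/dx x^{z} = z·x^{z−1}` for real `x > 0` (also for `z = 0`).
[cite: Zhang2022LandauSiegel, §4 Lemma 4.1 (proof)] -/
theorem hasDerivAt_ofReal_cpow (z : ℂ) {x : ℝ} (hx : 0 < x) :
    HasDerivAt (fun y : ℝ => (y : ℂ) ^ z) (z * (x : ℂ) ^ (z - 1)) x := by
  rcases eq_or_ne z 0 with rfl | hz
  · simp only [Complex.cpow_zero, zero_mul]
    exact hasDerivAt_const _ _
  · exact hasDerivAt_ofReal_cpow_const hx.ne' hz

/-- Continuity of `x ↦ x^{w}` on `[a, b]`, `a > 0`. [folklore] -/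
private lemma continuousOn_cpow (w : ℂ) {a b : ℝ} (ha : 0 < a) :
    ContinuousOn (fun y : ℝ => (y : ℂ) ^ w) (Set.Icc a b) := fun y hy =>
  (Complex.continuousAt_ofReal_cpow_const y w (Or.inr (ha.trans_le hy.1).ne')).continuousWithinAt

/-- Differentiability hypothesis of Abel summation for `f(x) = x^z`. [folklore] -/
private lemma hf_diff (z : ℂ) {a b : ℝ} (ha : 0 < a) :
    ∀ t ∈ Set.Icc a b, DifferentiableAt ℝ (fun y : ℝ => (y : ℂ) ^ z) t := fun _ ht =>
  (hasDerivAt_ofReal_cpow z (ha.trans_le ht.1)).differentiableAt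

/-- The derivative of `f(x) = x^z` on `[a, b]`. [folklore] -/
private lemma hf_deriv (z : ℂ) {a b : ℝ} (ha : 0 < a) :
    Set.EqOn (deriv (fun y : ℝ => (y : ℂ) ^ z)) (fun t : ℝ => z * (t : ℂ) ^ (z - 1))
      (Set.Icc a b) := fun _ ht =>
  (hasDerivAt_ofReal_cpow z (ha.trans_le ht.1)).deriv

/-- Integrability hypothesis of Abel summation for `f(x) = x^z`. [folklore] -/
private lemma hf_int (z : ℂ) {a b : ℝ} (ha : 0 < a) :
    IntegrableOn (deriv (fun y : ℝ => (y : ℂ) ^ z)) (Set.Icc a b) := by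
  have hc : ContinuousOn (fun t : ℝ => z * (t : ℂ) ^ (z - 1)) (Set.Icc a b) :=
    continuousOn_const.mul (continuousOn_cpow _ ha)
  exact hc.integrableOn_Icc.congr_fun (hf_deriv z ha).symm measurableSet_Icc

/-- The step function `Σ_{m≤k≤x} c(k)` times a continuous weight is integrable on `[a, b]`, `a ≥ 0`
(Mathlib `integrableOn_mul_sum_Icc`). [folklore] -/
private lemma integrableOn_mul_sum (c : ℕ → ℂ) (m : ℕ) {a b : ℝ} (ha : 0 ≤ a) {g : ℝ → ℂ}
    (hg : ContinuousOn g (Set.Icc a b)) :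
    IntegrableOn (fun t : ℝ => g t * ∑ k ∈ Finset.Icc m ⌊t⌋₊, c k) (Set.Icc a b) :=
  integrableOn_mul_sum_Icc c ha hg.integrableOn_Icc

/-! ### "By the Stieltjes integral … by partial integration" -/

/-- Abel summation for `f(x) = x^z` against the coefficients truncated to `k > m`, on `[a, b]`,
`0 < a`. [folklore] -/
private lemma abel_cpow (c : ℕ → ℂ) (m : ℕ) {a b : ℝ} (ha : 0 < a) (hab : a ≤ b) (z : ℂ) :
    ∑ k ∈ Finset.Ioc ⌊a⌋₊ ⌊b⌋₊, ((k : ℝ) : ℂ) ^ z * ctrunc c m k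
      = (b : ℂ) ^ z * (∑ k ∈ Finset.Icc (m + 1) ⌊b⌋₊, c k)
        - (a : ℂ) ^ z * (∑ k ∈ Finset.Icc (m + 1) ⌊a⌋₊, c k)
        - z * ∫ x in a..b, (∑ k ∈ Finset.Icc (m + 1) ⌊x⌋₊, c k) * (x : ℂ) ^ (z - 1) := by
  have hA := sum_mul_eq_sub_sub_integral_mul (ctrunc c m) ha.le hab (hf_diff z ha) (hf_int z ha)
  rw [hA, sum_Icc_ctrunc, sum_Icc_ctrunc, ← intervalIntegral.integral_of_le hab]
  congr 1
  have hI : ∫ t in a..b, deriv (fun y : ℝ => (y : ℂ) ^ z) t * ∑ k ∈ Finset.Icc 0 ⌊t⌋₊, ctrunc c m k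
      = ∫ t in a..b, z * ((∑ k ∈ Finset.Icc (m + 1) ⌊t⌋₊, c k) * (t : ℂ) ^ (z - 1)) := by
    refine intervalIntegral.integral_congr fun t ht => ?_
    rw [Set.uIcc_of_le hab] at ht
    rw [hf_deriv z ha ht, sum_Icc_ctrunc]
    ring
  rw [hI, intervalIntegral.integral_const_mul]

/-- **The Stieltjes / partial-integration identity, EXACT** (Lemma 4.2's
"`Σ_{D⁴<n≤D⁸} ς(n)ψ(n)n^{−s} = ∫_{D⁴}^{D⁸} x^{s₀−s} d{X₄(x,ψ)}`" integrated by parts; also the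
display after (4.8)): for `0 < a ≤ b` and any `z`,
`Σ_{a<n≤b} c(n)n^{z} = b^{z}X_a(b) − z∫_a^b X_a(x)x^{z−1}dx`.
[cite: Zhang2022LandauSiegel, §4 Lemma 4.2 (proof)] -/
theorem sum_mul_cpow_eq (c : ℕ → ℂ) {a b : ℝ} (ha : 0 < a) (hab : a ≤ b) (z : ℂ) :
    ∑ n ∈ Finset.Ioc ⌊a⌋₊ ⌊b⌋₊, c n * (n : ℂ) ^ z
      = (b : ℂ) ^ z * Xsum c a b - z * ∫ x in a..b, Xsum c a x * (x : ℂ) ^ (z - 1) := by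
  have hA := abel_cpow c ⌊a⌋₊ ha hab z
  have hL : ∑ k ∈ Finset.Ioc ⌊a⌋₊ ⌊b⌋₊, ((k : ℝ) : ℂ) ^ z * ctrunc c ⌊a⌋₊ k
      = ∑ n ∈ Finset.Ioc ⌊a⌋₊ ⌊b⌋₊, c n * (n : ℂ) ^ z := by
    refine Finset.sum_congr rfl fun k hk => ?_
    rw [Finset.mem_Ioc] at hk
    simp only [ctrunc, if_pos hk.1, Complex.ofReal_natCast]
    ring
  rw [hL] at hA
  rw [hA]
  simp only [← Xsum_def]
  rw [Xsum_self, mul_zero, sub_zero]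

/-- **Lemma 4.1's first display, EXACT** ("`F(s,ψ)^{20} = 1 + ∫₁^{D^{80}} x^{s₀−s} d{X₁(x,ψ)}`",
integrated by parts; the "`1`" is the term `n = 1`): for `1 ≤ b` and any `z`, with
`X(x) = Σ_{1≤n≤x} c(n)`: `Σ_{1≤n≤b} c(n)n^{z} = b^{z}X(b) − z∫₁^b X(x)x^{z−1}dx`.
[cite: Zhang2022LandauSiegel, §4 Lemma 4.1 (proof)] -/
theorem sum_mul_cpow_eq_one (c : ℕ → ℂ) {b : ℝ} (hb : 1 ≤ b) (z : ℂ) :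
    ∑ n ∈ Finset.Icc 1 ⌊b⌋₊, c n * (n : ℂ) ^ z
      = (b : ℂ) ^ z * Xsum c 0 b - z * ∫ x in (1 : ℝ)..b, Xsum c 0 x * (x : ℂ) ^ (z - 1) := by
  have hA := abel_cpow c 0 one_pos hb z
  have hfl : ⌊(1 : ℝ)⌋₊ = 1 := Nat.floor_one
  rw [hfl] at hA
  have hb1 : 1 ≤ ⌊b⌋₊ := by
    rw [← hfl]
    exact Nat.floor_le_floor hb
  -- left side of Abel = the sum over `n ≥ 2`
  have hL : ∑ k ∈ Finset.Ioc 1 ⌊b⌋₊, ((k : ℝ) : ℂ) ^ z * ctrunc c 0 k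
      = ∑ n ∈ Finset.Ioc 1 ⌊b⌋₊, c n * (n : ℂ) ^ z := by
    refine Finset.sum_congr rfl fun k hk => ?_
    rw [Finset.mem_Ioc] at hk
    simp only [ctrunc, if_pos (zero_lt_one.trans hk.1), Complex.ofReal_natCast]
    ring
  rw [hL] at hA
  -- split off `n = 1`
  have hsplit : ∑ n ∈ Finset.Icc 1 ⌊b⌋₊, c n * (n : ℂ) ^ z
      = c 1 + ∑ n ∈ Finset.Ioc 1 ⌊b⌋₊, c n * (n : ℂ) ^ z := by
    rw [Finset.Icc_eq_cons_Ioc hb1, Finset.sum_cons]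
    simp
  have hone : ∑ k ∈ Finset.Icc (0 + 1) 1, c k = c 1 := by simp
  rw [hsplit, hA, hone, Complex.ofReal_one, Complex.one_cpow, one_mul]
  simp only [zero_add, ← Xsum_zero]
  ring

/-! ### The partial-integration bound -/

/-- The norm bound behind "Hence, by partial integration": for `0 < a ≤ b`, a step function
`S`, and `x^{Re z} ≤ M` on `[a,b]`,
`‖b^{z}S(b) − z∫_a^b S(x)x^{z−1}dx‖ ≤ M‖S(b)‖ + ‖z‖M∫_a^b ‖S(x)‖x⁻¹dx`. [folklore] -/
private lemma norm_main_le (c : ℕ → ℂ) (m : ℕ) {a b : ℝ} (ha : 0 < a) (hab : a ≤ b) (z : ℂ)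
    {M : ℝ} (hM : ∀ x ∈ Set.Icc a b, x ^ z.re ≤ M) :
    ‖(b : ℂ) ^ z * (∑ k ∈ Finset.Icc m ⌊b⌋₊, c k)
        - z * ∫ x in a..b, (∑ k ∈ Finset.Icc m ⌊x⌋₊, c k) * (x : ℂ) ^ (z - 1)‖
      ≤ M * ‖∑ k ∈ Finset.Icc m ⌊b⌋₊, c k‖
        + ‖z‖ * M * ∫ x in a..b, ‖∑ k ∈ Finset.Icc m ⌊x⌋₊, c k‖ / x := by
  set S : ℝ → ℂ := fun x => ∑ k ∈ Finset.Icc m ⌊x⌋₊, c k with hS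
  have hb : 0 < b := ha.trans_le hab
  have hMb : ‖(b : ℂ) ^ z‖ ≤ M := by
    rw [Complex.norm_cpow_eq_rpow_re_of_pos hb]
    exact hM b ⟨hab, le_rfl⟩
  -- integrability of the two integrands
  have hint1 : IntervalIntegrable (fun x : ℝ => S x * (x : ℂ) ^ (z - 1)) volume a b := by
    rw [intervalIntegrable_iff_integrableOn_Icc_of_le hab]
    have h := integrableOn_mul_sum c m ha.le (continuousOn_cpow (z - 1) ha) (b := b)
    exact h.congr_fun (fun x _ => by simp only [hS]; ring) measurableSet_Icc
  have hint2 : IntervalIntegrable (fun x : ℝ => ‖S x‖ / x) volume a b := by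
    rw [intervalIntegrable_iff_integrableOn_Icc_of_le hab]
    have hg : ContinuousOn (fun x : ℝ => ((x : ℂ))⁻¹) (Set.Icc a b) :=
      Complex.continuous_ofReal.continuousOn.inv₀
        fun x hx => Complex.ofReal_ne_zero.mpr (ha.trans_le hx.1).ne'
    have h : IntegrableOn (fun x : ℝ => ‖((x : ℂ))⁻¹ * ∑ k ∈ Finset.Icc m ⌊x⌋₊, c k‖)
        (Set.Icc a b) := MeasureTheory.Integrable.norm (integrableOn_mul_sum c m ha.le hg (b := b))
    refine h.congr_fun (fun x hx => ?_) measurableSet_Icc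
    have hx : 0 < x := ha.trans_le hx.1
    simp only [hS]
    rw [norm_mul, norm_inv, Complex.norm_real, Real.norm_eq_abs, abs_of_pos hx, inv_mul_eq_div]
  -- pointwise bound of the integrand
  have hpt : ∀ x ∈ Set.Icc a b, ‖S x * (x : ℂ) ^ (z - 1)‖ ≤ M * (‖S x‖ / x) := by
    intro x hx
    have hx0 : 0 < x := ha.trans_le hx.1
    rw [norm_mul, Complex.norm_cpow_eq_rpow_re_of_pos hx0, Complex.sub_re, Complex.one_re,
      Real.rpow_sub_one hx0.ne']
    have h1 := hM x hx
    have hXn := norm_nonneg (S x)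
    calc ‖S x‖ * (x ^ z.re / x) = x ^ z.re * (‖S x‖ / x) := by ring
      _ ≤ M * (‖S x‖ / x) := mul_le_mul_of_nonneg_right h1 (div_nonneg hXn hx0.le)
  have hI : ‖∫ x in a..b, S x * (x : ℂ) ^ (z - 1)‖ ≤ M * ∫ x in a..b, ‖S x‖ / x := by
    calc ‖∫ x in a..b, S x * (x : ℂ) ^ (z - 1)‖
        ≤ ∫ x in a..b, ‖S x * (x : ℂ) ^ (z - 1)‖ :=
          intervalIntegral.norm_integral_le_integral_norm hab
      _ ≤ ∫ x in a..b, M * (‖S x‖ / x) :=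
          intervalIntegral.integral_mono_on hab hint1.norm (hint2.const_mul M) hpt
      _ = M * ∫ x in a..b, ‖S x‖ / x := intervalIntegral.integral_const_mul M _
  calc ‖(b : ℂ) ^ z * S b - z * ∫ x in a..b, S x * (x : ℂ) ^ (z - 1)‖
      ≤ ‖(b : ℂ) ^ z * S b‖ + ‖z * ∫ x in a..b, S x * (x : ℂ) ^ (z - 1)‖ := norm_sub_le _ _
    _ = ‖(b : ℂ) ^ z‖ * ‖S b‖ + ‖z‖ * ‖∫ x in a..b, S x * (x : ℂ) ^ (z - 1)‖ := by
        rw [norm_mul, norm_mul]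
    _ ≤ M * ‖S b‖ + ‖z‖ * (M * ∫ x in a..b, ‖S x‖ / x) :=
        add_le_add (mul_le_mul_of_nonneg_right hMb (norm_nonneg _))
          (mul_le_mul_of_nonneg_left hI (norm_nonneg _))
    _ = M * ‖S b‖ + ‖z‖ * M * ∫ x in a..b, ‖S x‖ / x := by ring

/-- **"Hence, by partial integration"** (Lemma 4.2's display
"`FG − 1 ≪ 𝓛^{406}(|X₄(D⁸,ψ)| + ∫_{D⁴}^{D⁸}|X₄(x,ψ)|x⁻¹dx)`" and the display after (4.8), with the two
suprema explicit): for `0 < a ≤ b` and `x^{Re z} ≤ M` on `[a, b]`,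
`|Σ_{a<n≤b} c(n)n^{z}| ≤ M|X_a(b)| + |z|·M·∫_a^b |X_a(x)|x⁻¹dx`.
[cite: Zhang2022LandauSiegel, §4 Lemma 4.2 (proof)] -/
theorem norm_sum_mul_cpow_le (c : ℕ → ℂ) {a b : ℝ} (ha : 0 < a) (hab : a ≤ b) (z : ℂ) {M : ℝ}
    (hM : ∀ x ∈ Set.Icc a b, x ^ z.re ≤ M) :
    ‖∑ n ∈ Finset.Ioc ⌊a⌋₊ ⌊b⌋₊, c n * (n : ℂ) ^ z‖
      ≤ M * ‖Xsum c a b‖ + ‖z‖ * M * ∫ x in a..b, ‖Xsum c a x‖ / x := by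
  rw [sum_mul_cpow_eq c ha hab z]
  simp only [Xsum_def]
  exact norm_main_le c (⌊a⌋₊ + 1) ha hab z hM

/-- **"Hence, by partial integration"** (Lemma 4.1's display
"`|F(s,ψ)|^{20} ≪ 1 + 𝓛^{406}(|X₁(D^{80},ψ)| + ∫₁^{D^{80}}|X₁(x,ψ)|x⁻¹dx)`", with the two suprema
explicit and without the superfluous "`1 +`"): for `1 ≤ b` and `x^{Re z} ≤ M` on `[1, b]`,
`|Σ_{n≤b} c(n)n^{z}| ≤ M|X(b)| + |z|·M·∫₁^b |X(x)|x⁻¹dx`.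
[cite: Zhang2022LandauSiegel, §4 Lemma 4.1 (proof)] -/
theorem norm_sum_mul_cpow_le_one (c : ℕ → ℂ) {b : ℝ} (hb : 1 ≤ b) (z : ℂ) {M : ℝ}
    (hM : ∀ x ∈ Set.Icc 1 b, x ^ z.re ≤ M) :
    ‖∑ n ∈ Finset.Icc 1 ⌊b⌋₊, c n * (n : ℂ) ^ z‖
      ≤ M * ‖Xsum c 0 b‖ + ‖z‖ * M * ∫ x in (1 : ℝ)..b, ‖Xsum c 0 x‖ / x := by
  rw [sum_mul_cpow_eq_one c hb z]
  simp only [Xsum_zero]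
  exact norm_main_le c 1 one_pos hb z hM

/-! ### The two pointwise bounds on `Ω₁` -/

/-- **"`|x^{s₀−s}| ≪ 𝓛` for `s ∈ Ω₁` and `1 ≤ x ≤ D^{80}`", EXACT**: with `𝓛 ≥ 1`, `D^{80} = e^{80𝓛}`
and `Re(s₀ − s) = 1/2 − σ ≤ (100𝓛)⁻¹ log 𝓛`: `|x^{s₀−s}| = x^{Re(s₀−s)} ≤ 𝓛^{4/5}`.
[cite: Zhang2022LandauSiegel, §4 Lemma 4.1 (proof)] -/
theorem rpow_re_le {L x : ℝ} (hL : 1 ≤ L) (hx1 : 1 ≤ x) (hxX : x ≤ Real.exp (80 * L)) {z : ℂ}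
    (hz : z.re ≤ Real.log L / (100 * L)) : x ^ z.re ≤ L ^ (4 / 5 : ℝ) := by
  have hL0 : 0 < L := by linarith
  have hη : 0 ≤ Real.log L / (100 * L) := div_nonneg (Real.log_nonneg hL) (by positivity)
  calc x ^ z.re ≤ x ^ (Real.log L / (100 * L)) := Real.rpow_le_rpow_of_exponent_le hx1 hz
    _ ≤ (Real.exp (80 * L)) ^ (Real.log L / (100 * L)) :=
        Real.rpow_le_rpow (by linarith) hxX hη
    _ = L ^ (4 / 5 : ℝ) := by
        rw [← Real.exp_mul, Real.rpow_def_of_pos hL0]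
        congr 1
        field_simp
        ring

/-- The same for the complex power: `‖x^{z}‖ ≤ 𝓛^{4/5}`. [cite: Zhang2022LandauSiegel, §4 Lemma 4.1 (proof)] -/
theorem norm_cpow_le {L x : ℝ} (hL : 1 ≤ L) (hx1 : 1 ≤ x) (hxX : x ≤ Real.exp (80 * L)) {z : ℂ}
    (hz : z.re ≤ Real.log L / (100 * L)) : ‖(x : ℂ) ^ z‖ ≤ L ^ (4 / 5 : ℝ) := by
  rw [Complex.norm_cpow_eq_rpow_re_of_pos (by linarith)]
  exact rpow_re_le hL hx1 hxX hz

/-- **"`|d/dx (x^{s₀−s})| ≪ x^{−1}𝓛^{406}`"**, first half: `d/dx x^{z} = z·x^{z−1}`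
(`hasDerivAt_ofReal_cpow`) and `|z·x^{z−1}| ≤ |z|·𝓛^{4/5}/x` for `1 ≤ x ≤ e^{80𝓛}`,
`Re z ≤ (100𝓛)⁻¹log 𝓛`. [cite: Zhang2022LandauSiegel, §4 Lemma 4.1 (proof)] -/
theorem norm_deriv_cpow_le {L x : ℝ} (hL : 1 ≤ L) (hx1 : 1 ≤ x) (hxX : x ≤ Real.exp (80 * L))
    {z : ℂ} (hz : z.re ≤ Real.log L / (100 * L)) :
    ‖z * (x : ℂ) ^ (z - 1)‖ ≤ ‖z‖ * L ^ (4 / 5 : ℝ) / x := by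
  have hx0 : 0 < x := by linarith
  rw [norm_mul, Complex.norm_cpow_eq_rpow_re_of_pos hx0, Complex.sub_re, Complex.one_re,
    Real.rpow_sub_one hx0.ne', mul_div_assoc]
  exact mul_le_mul_of_nonneg_left (div_le_div_of_nonneg_right (rpow_re_le hL hx1 hxX hz) hx0.le)
    (norm_nonneg z)

/-- **"`|d/dx (x^{s₀−s})| ≪ x^{−1}𝓛^{406}`"**, second half — the exponent `406 = 405 + 1 ≥ 405 + 4/5`:
on `Ω₁` one has `|Re z| ≤ 1`, `|Im z| = |t − 2πt₀| ≤ 𝓛₁ + 5 = 𝓛^{405} + 5`, so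
`|z| ≤ 𝓛^{405} + 6` and `(𝓛^{405} + 6)·𝓛^{4/5} ≤ 𝓛^{406}` as soon as `𝓛 ≥ 32`.
[cite: Zhang2022LandauSiegel, §4 Lemma 4.1 (proof)] -/
theorem norm_mul_le_rpow_406 {L : ℝ} (hL : 32 ≤ L) {z : ℂ} (hre : |z.re| ≤ 1)
    (him : |z.im| ≤ L ^ (405 : ℝ) + 5) : ‖z‖ * L ^ (4 / 5 : ℝ) ≤ L ^ (406 : ℝ) := by
  have hL0 : 0 < L := by linarith
  have hz : ‖z‖ ≤ L ^ (405 : ℝ) + 6 :=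
    (Complex.norm_le_abs_re_add_abs_im z).trans (by linarith)
  have h15 : (2 : ℝ) ≤ L ^ (1 / 5 : ℝ) := by
    have h32 : (32 : ℝ) ^ (1 / 5 : ℝ) = 2 := by
      rw [show (32 : ℝ) = 2 ^ (5 : ℝ) by norm_num, ← Real.rpow_mul (by norm_num)]
      norm_num
    rw [← h32]
    exact Real.rpow_le_rpow (by norm_num) hL (by norm_num)
  have hsplit : L ^ (406 : ℝ) = L ^ (405 : ℝ) * L ^ (1 / 5 : ℝ) * L ^ (4 / 5 : ℝ) := by
    rw [← Real.rpow_add hL0, ← Real.rpow_add hL0]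
    norm_num
  have h405 : (6 : ℝ) ≤ L ^ (405 : ℝ) :=
    calc (6 : ℝ) ≤ 32 := by norm_num
      _ ≤ L := hL
      _ = L ^ (1 : ℝ) := (Real.rpow_one L).symm
      _ ≤ L ^ (405 : ℝ) := Real.rpow_le_rpow_of_exponent_le (by linarith) (by norm_num)
  have h45 : 0 < L ^ (4 / 5 : ℝ) := Real.rpow_pos_of_pos hL0 _
  have hkey : L ^ (405 : ℝ) + 6 ≤ L ^ (405 : ℝ) * L ^ (1 / 5 : ℝ) := by nlinarith
  rw [hsplit]
  calc ‖z‖ * L ^ (4 / 5 : ℝ) ≤ (L ^ (405 : ℝ) + 6) * L ^ (4 / 5 : ℝ) :=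
        mul_le_mul_of_nonneg_right hz h45.le
    _ ≤ (L ^ (405 : ℝ) * L ^ (1 / 5 : ℝ)) * L ^ (4 / 5 : ℝ) :=
        mul_le_mul_of_nonneg_right hkey h45.le

/-! ### Lemma 4.1 / 4.2: the third display assembled (modulo (3.4)–(3.6)) -/

/-- **Lemma 4.1's third display, explicit**: for `𝓛 ≥ 32`, `1 ≤ b ≤ D^{80} = e^{80𝓛}`, and
`z = s₀ − s` with `Re z ≤ (100𝓛)⁻¹log 𝓛`, `|Re z| ≤ 1`, `|Im z| ≤ 𝓛^{405} + 5` (i.e. `s ∈ Ω₁`):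
`|Σ_{n≤b} c(n)n^{z}| ≤ 𝓛^{4/5}|X(b)| + 𝓛^{406}∫₁^b |X(x)|x⁻¹dx` — with `c(n) = ν₂₀(n)ψ(n)n^{−s₀}`,
`b = D^{80}` this is "`|F(s,ψ)|^{20} ≪ 1 + 𝓛^{406}(|X₁(D^{80},ψ)| + ∫₁^{D^{80}}|X₁(x,ψ)|x⁻¹dx)`".
[cite: Zhang2022LandauSiegel, §4 Lemma 4.1 (proof)] -/
theorem norm_F20_le (c : ℕ → ℂ) {L b : ℝ} (hL : 32 ≤ L) (hb1 : 1 ≤ b)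
    (hbX : b ≤ Real.exp (80 * L)) {z : ℂ} (hz : z.re ≤ Real.log L / (100 * L))
    (hre : |z.re| ≤ 1) (him : |z.im| ≤ L ^ (405 : ℝ) + 5) :
    ‖∑ n ∈ Finset.Icc 1 ⌊b⌋₊, c n * (n : ℂ) ^ z‖
      ≤ L ^ (4 / 5 : ℝ) * ‖Xsum c 0 b‖ + L ^ (406 : ℝ) * ∫ x in (1 : ℝ)..b, ‖Xsum c 0 x‖ / x := by
  have hL1 : 1 ≤ L := by linarith
  have hM : ∀ x ∈ Set.Icc 1 b, x ^ z.re ≤ L ^ (4 / 5 : ℝ) := fun x hx =>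
    rpow_re_le hL1 hx.1 (hx.2.trans hbX) hz
  have h1 := norm_sum_mul_cpow_le_one c hb1 z hM
  have hI0 : 0 ≤ ∫ x in (1 : ℝ)..b, ‖Xsum c 0 x‖ / x :=
    intervalIntegral.integral_nonneg hb1 fun x hx => div_nonneg (norm_nonneg _) (by linarith [hx.1])
  have h2 : ‖z‖ * L ^ (4 / 5 : ℝ) * ∫ x in (1 : ℝ)..b, ‖Xsum c 0 x‖ / x
      ≤ L ^ (406 : ℝ) * ∫ x in (1 : ℝ)..b, ‖Xsum c 0 x‖ / x :=
    mul_le_mul_of_nonneg_right (norm_mul_le_rpow_406 hL hre him) hI0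
  linarith

/-- **Lemma 4.2's display, explicit** (and (4.8)'s): the same on a range `(a, b]` with
`1 ≤ a ≤ b ≤ e^{80𝓛}` — `|Σ_{a<n≤b} c(n)n^{z}| ≤ 𝓛^{4/5}|X_a(b)| + 𝓛^{406}∫_a^b |X_a(x)|x⁻¹dx`; with
`c(n) = ς(n)ψ(n)n^{−s₀}`, `a = D⁴`, `b = D⁸` this is
"`F(s,ψ)G(s,ψ) − 1 ≪ 𝓛^{406}(|X₄(D⁸,ψ)| + ∫_{D⁴}^{D⁸}|X₄(x,ψ)|x⁻¹dx)`".
[cite: Zhang2022LandauSiegel, §4 Lemma 4.2 (proof)] -/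
theorem norm_sum_Ioc_le (c : ℕ → ℂ) {L a b : ℝ} (hL : 32 ≤ L) (ha1 : 1 ≤ a) (hab : a ≤ b)
    (hbX : b ≤ Real.exp (80 * L)) {z : ℂ} (hz : z.re ≤ Real.log L / (100 * L))
    (hre : |z.re| ≤ 1) (him : |z.im| ≤ L ^ (405 : ℝ) + 5) :
    ‖∑ n ∈ Finset.Ioc ⌊a⌋₊ ⌊b⌋₊, c n * (n : ℂ) ^ z‖
      ≤ L ^ (4 / 5 : ℝ) * ‖Xsum c a b‖ + L ^ (406 : ℝ) * ∫ x in a..b, ‖Xsum c a x‖ / x := by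
  have hL1 : 1 ≤ L := by linarith
  have ha : 0 < a := by linarith
  have hM : ∀ x ∈ Set.Icc a b, x ^ z.re ≤ L ^ (4 / 5 : ℝ) := fun x hx =>
    rpow_re_le hL1 (ha1.trans hx.1) (hx.2.trans hbX) hz
  have h1 := norm_sum_mul_cpow_le c ha hab z hM
  have hI0 : 0 ≤ ∫ x in a..b, ‖Xsum c a x‖ / x :=
    intervalIntegral.integral_nonneg hab fun x hx =>
      div_nonneg (norm_nonneg _) (by linarith [hx.1])
  have h2 : ‖z‖ * L ^ (4 / 5 : ℝ) * ∫ x in a..b, ‖Xsum c a x‖ / x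
      ≤ L ^ (406 : ℝ) * ∫ x in a..b, ‖Xsum c a x‖ / x :=
    mul_le_mul_of_nonneg_right (norm_mul_le_rpow_406 hL hre him) hI0
  linarith

/-- The last step of Lemma 4.1: "`|F|^{20} ≤ 𝓛^{e}` ⇒ `|F| ≤ 𝓛^{e/20}`" (with (3.4): `e = 406 + 1171`,
`e/20 = 78.85 < 79`). [cite: Zhang2022LandauSiegel, §4 Lemma 4.1 (proof)] -/
theorem norm_le_rpow_of_pow_le {F : ℂ} {L e : ℝ} (hL : 0 < L) (h : ‖F‖ ^ 20 ≤ L ^ e) :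
    ‖F‖ ≤ L ^ (e / 20) := by
  have h1 : (‖F‖ ^ 20) ^ ((20 : ℕ)⁻¹ : ℝ) = ‖F‖ :=
    Real.pow_rpow_inv_natCast (norm_nonneg F) (by norm_num)
  have h2 : (‖F‖ ^ 20) ^ ((20 : ℕ)⁻¹ : ℝ) ≤ (L ^ e) ^ ((20 : ℕ)⁻¹ : ℝ) :=
    Real.rpow_le_rpow (by positivity) h (by positivity)
  rw [h1, ← Real.rpow_mul hL.le] at h2
  have h3 : e * ((20 : ℕ)⁻¹ : ℝ) = e / 20 := by
    push_cast
    ring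
  rwa [h3] at h2

/-- Numerical instance of the last step: `(406 + 1171)/20 < 79`, i.e. (3.4)'s `𝓛^{1171}` and the
`𝓛^{406}` of the partial integration give `|F| ≪ 𝓛^{79}`. [cite: Zhang2022LandauSiegel, §4 Lemma 4.1] -/
theorem exponent_lemma41 : ((406 : ℝ) + 1171) / 20 < 79 := by norm_num

end Lemma41

end Literature.NumberTheory.LFunctions.Zhang2022
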